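import Mathlib.RingTheory.MvPolynomial.Basic
import Mathlib.Algebra.MvPolynomial.CommRing
import Mathlib.Algebra.CharP.Lemmas
import Mathlib.Algebra.Polynomial.Coeff
import HarnessLib

/-!
# The low-order identity of a rectified pure slot: `Ψ̄*G₀ − G₀ = −c^p σ^{jp} · Ψ̄*R` (T28 (iii) core)

Uniform value line: INSTRUMENT — kernel-checked identity core for the polynomial weighted-centre
model `W(f)` of the cell (engine 1's toy-model lemmas: THEOREM-FS-eng1-g35 §9.1 display (1), the
"ORDER-`s` IDENTITY" of CARVER-NOTES-eng1-g35 T28 (iii)) — NOT a resolution theorem, NOT a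
statement about the Abramovich–Temkin–Włodarczyk invariant, NOT summit progress; AI-written Lean,
AI review is weaker than expert review.

## Setting ("B-world", as in `WeightedCentrePureCofactor`)

`k` a commutative ring of prime characteristic `p`; `B := k[σ][ε_ι] = MvPolynomial ι k[X]`
(`X = σ`, the `MvPolynomial` variables are the slots `ε_i`); a substitution `Ψ = aeval φ` over
`k[σ]` (`Ψ (ε_i) = φ i ∈ B`, `σ` fixed); a slot `a₀` whose image is EXACTLY the pure shift
`Ψ (ε_{a₀}) = ε_{a₀} + c σ^j`; a polynomial `G = G₀ + ε_{a₀}^p · R` with `G₀` free of `ε_{a₀}`.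
`Ψ̄ := Ψ mod ε_{a₀}` is `killSlot a₀ ∘ Ψ` (`killSlot a₀ : ε_{a₀} ↦ 0`).

* `killSlot` and its plumbing (`killSlot_X_self`, `killSlot_X_of_ne`, `killSlot_C`,
  `killSlot_eq_self_of_notMem_vars`, `killSlot_X_pow_mul`).
* `frobenius_pureShift` : `(ε_{a₀} + c σ^j)^p = ε_{a₀}^p + c^p σ^{jp}` in `B` (Frobenius).
* `killSlot_aeval_eq_sub` (**identity (1)**): if `Ψ G = G` then
  `Ψ̄*G₀ = G₀ − c^p σ^{jp} · Ψ̄*R`, i.e.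
  `killSlot a₀ (Ψ G₀) = G₀ − C (c^p σ^{jp}) * killSlot a₀ (Ψ R)`.
* `coeff_coeff_killSlot_aeval_eq_zero` (**the order-`s` identity**): if moreover `G₀` is `σ`-free
  (every coefficient a constant of `k[σ]`), then `[σ^s ε^t] (Ψ̄*G₀) = 0` for `1 ≤ s < j·p` and
  every monomial `t`; `…_map` is the form with `G₀ = map C G₀'`, `G₀' ∈ k[ε_ι]`.

Dictionary (THEOREM-FS §9.1): `a₀`-rectified coordinates (T9 LEMMA D) give exactly the hypotheses
`hφ` and `hiso`; the conclusion is "`[σ^s](Ψ̄*G₀) = [σ^s] G₀ = 0` for `1 ≤ s < j*p`", the input of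
the clean-supplier readings of LEMMA CS.  No weights, no window inequalities are needed here.

References (context only; the identity is elementary and derived here):
[AbramovichTemkinWlodarczyk2024] Thm. 5.3.1 (2)–(3) (p. 1578) (graded automorphisms of the
graded algebra of a weighted centre); [Matsumura1987] §25 (substitutions of polynomial rings).
-/

namespace Literature.AlgebraicGeometry.Resolution.WeightedBlowup

open MvPolynomial
open scoped Polynomial

/-! ## §1 Killing one slot: `Ψ̄ = Ψ mod ε_{a₀}` -/

section Kill

variable {S : Type*} [CommSemiring S] {ι : Type*} [DecidableEq ι]

/-- The `S`-algebra endomorphism `ε_{a₀} ↦ 0`, every other slot fixed ("reduce modulo `ε_{a₀}`"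
on polynomials free of higher structure). [cite: Matsumura1987, §25 (substitutions of polynomial rings)] -/
noncomputable def killSlot (a₀ : ι) : MvPolynomial ι S →ₐ[S] MvPolynomial ι S :=
  aeval fun i => if i = a₀ then 0 else X i

/-- (derived here) [cite: Matsumura1987, §25] -/
@[simp] theorem killSlot_X_self (a₀ : ι) : killSlot a₀ (X a₀ : MvPolynomial ι S) = 0 := by
  simp [killSlot]

/-- (derived here) [cite: Matsumura1987, §25] -/
theorem killSlot_X_of_ne {a₀ i : ι} (h : i ≠ a₀) : killSlot a₀ (X i : MvPolynomial ι S) = X i := by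
  simp [killSlot, h]

/-- (derived here) [cite: Matsumura1987, §25] -/
@[simp] theorem killSlot_C (a₀ : ι) (s : S) : killSlot a₀ (C s : MvPolynomial ι S) = C s :=
  algHom_C _ s

/-- A polynomial free of `ε_{a₀}` is fixed by `killSlot a₀` (derived here). [cite: Matsumura1987, §25] -/
theorem killSlot_eq_self_of_notMem_vars {a₀ : ι} {F : MvPolynomial ι S} (hF : a₀ ∉ F.vars) :
    killSlot a₀ F = F := by
  have := hom_congr_vars (f₁ := (killSlot (S := S) a₀).toRingHom) (f₂ := RingHom.id _)
    (p₁ := F) (p₂ := F) (RingHom.ext fun r => by simp)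
    (fun i hi _ => by
      have hne : i ≠ a₀ := fun h => hF (h ▸ hi)
      simpa using killSlot_X_of_ne hne) rfl
  simpa using this

/-- `killSlot a₀ (ε_{a₀}^n · F) = 0` for `n ≥ 1` (derived here). [cite: Matsumura1987, §25] -/
theorem killSlot_X_pow_mul (a₀ : ι) {n : ℕ} (hn : n ≠ 0) (F : MvPolynomial ι S) :
    killSlot a₀ (X a₀ ^ n * F) = 0 := by
  rw [map_mul, map_pow, killSlot_X_self, zero_pow hn, zero_mul]

/-- `killSlot a₀ ∘ aeval φ = aeval (killSlot a₀ ∘ φ)`: `Ψ̄ = Ψ mod ε_{a₀}` is again a substitution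
(derived here). [cite: Matsumura1987, §25] -/
theorem killSlot_aeval (a₀ : ι) (φ : ι → MvPolynomial ι S) (F : MvPolynomial ι S) :
    killSlot a₀ (aeval φ F) = aeval (fun i => killSlot a₀ (φ i)) F := by
  rw [← AlgHom.comp_apply, comp_aeval]

end Kill

/-! ## §2 The identity of a rectified pure slot -/

section LowOrder

variable {k : Type*} [CommRing k] (p : ℕ) [hp : Fact p.Prime] [CharP k p] {ι : Type*} [DecidableEq ι]

omit [DecidableEq ι] in
/-- Frobenius on the rectified slot: `(ε_{a₀} + c σ^j)^p = ε_{a₀}^p + c^p σ^{jp}` in `k[σ][ε_ι]`,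
`char k = p` (derived here). [cite: AbramovichTemkinWlodarczyk2024, Thm. 5.3.1 (2)–(3) (p. 1578)] -/
theorem frobenius_pureShift (a₀ : ι) (c : k) (j : ℕ) :
    ((X a₀ : MvPolynomial ι k[X]) + C (Polynomial.C c * Polynomial.X ^ j)) ^ p
      = X a₀ ^ p + C (Polynomial.C (c ^ p) * Polynomial.X ^ (j * p)) := by
  rw [add_pow_char, ← map_pow, mul_pow, ← Polynomial.C_pow, ← pow_mul]

/-- **Identity (1) of THEOREM-FS §9.1.**  `Ψ = aeval φ` with `Ψ (ε_{a₀}) = ε_{a₀} + c σ^j`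
exactly, `G = G₀ + ε_{a₀}^p R` with `G₀` free of `ε_{a₀}`, and `Ψ G = G`.  Then, with
`Ψ̄ := killSlot a₀ ∘ Ψ` (`Ψ mod ε_{a₀}`):  `Ψ̄*G₀ = G₀ − c^p σ^{jp} · Ψ̄*R` (derived here: apply
`killSlot a₀` to `Ψ G = G` and use Frobenius on the slot).
[cite: AbramovichTemkinWlodarczyk2024, Thm. 5.3.1 (2)–(3) (p. 1578)] -/
theorem killSlot_aeval_eq_sub (a₀ : ι) (φ : ι → MvPolynomial ι k[X]) (c : k) (j : ℕ)
    (hφ : φ a₀ = X a₀ + C (Polynomial.C c * Polynomial.X ^ j)) (G₀ R : MvPolynomial ι k[X])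
    (hG₀ : a₀ ∉ G₀.vars) (hiso : aeval φ (G₀ + X a₀ ^ p * R) = G₀ + X a₀ ^ p * R) :
    killSlot a₀ (aeval φ G₀)
      = G₀ - C (Polynomial.C (c ^ p) * Polynomial.X ^ (j * p)) * killSlot a₀ (aeval φ R) := by
  have h := congrArg (killSlot a₀) hiso
  rw [map_add (aeval φ), map_mul (aeval φ), map_pow (aeval φ), aeval_X, hφ,
    frobenius_pureShift p a₀ c j, map_add (killSlot a₀), map_mul (killSlot a₀),
    map_add (killSlot a₀), map_pow (killSlot a₀), killSlot_X_self, zero_pow hp.out.ne_zero,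
    zero_add, killSlot_C, map_add (killSlot a₀), killSlot_eq_self_of_notMem_vars hG₀,
    killSlot_X_pow_mul a₀ hp.out.ne_zero, add_zero] at h
  exact eq_sub_of_add_eq h

/-- `σ`-free polynomials of `k[σ][ε_ι]`: every `ε`-coefficient is a constant of `k[σ]` (the image of
`k[ε_ι]` under `map C`, cf. `isSigmaFree_map`). [cite: Matsumura1987, §25 (polynomial rings)] -/
def IsSigmaFree (G : MvPolynomial ι k[X]) : Prop := ∀ t : ι →₀ ℕ, ∀ s : ℕ, 1 ≤ s → (coeff t G).coeff s = 0

omit hp [CharP k p] [DecidableEq ι] in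
/-- `map C G₀'` is `σ`-free (derived here). [cite: Matsumura1987, §25] -/
theorem isSigmaFree_map (G₀' : MvPolynomial ι k) : IsSigmaFree (map Polynomial.C G₀') := by
  intro t s hs
  rw [coeff_map, Polynomial.coeff_C, if_neg (by omega)]

/-- **The order-`s` identity (T28 (iii)).**  In the setting of `killSlot_aeval_eq_sub`, if `G₀`
is `σ`-free then `[σ^s ε^t] (Ψ̄*G₀) = 0` for every `1 ≤ s < j·p` and every monomial `t`
(derived here: `[σ^s] G₀ = 0` for `s ≥ 1` and `σ^{jp}` divides the correction term).
[cite: AbramovichTemkinWlodarczyk2024, Thm. 5.3.1 (2)–(3) (p. 1578)] -/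
theorem coeff_coeff_killSlot_aeval_eq_zero (a₀ : ι) (φ : ι → MvPolynomial ι k[X]) (c : k)
    (j : ℕ) (hφ : φ a₀ = X a₀ + C (Polynomial.C c * Polynomial.X ^ j))
    (G₀ R : MvPolynomial ι k[X]) (hG₀ : a₀ ∉ G₀.vars) (hfree : IsSigmaFree G₀)
    (hiso : aeval φ (G₀ + X a₀ ^ p * R) = G₀ + X a₀ ^ p * R) {s : ℕ} (hs1 : 1 ≤ s)
    (hs : s < j * p) (t : ι →₀ ℕ) : ((killSlot a₀ (aeval φ G₀)).coeff t).coeff s = 0 := by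
  rw [killSlot_aeval_eq_sub p a₀ φ c j hφ G₀ R hG₀ hiso, coeff_sub, Polynomial.coeff_sub,
    hfree t s hs1, coeff_C_mul, mul_assoc, Polynomial.coeff_C_mul, Polynomial.coeff_X_pow_mul',
    if_neg (not_le.mpr hs), mul_zero, sub_zero]

/-- The order-`s` identity with `G₀ = map C G₀'`, `G₀' ∈ k[ε_ι]` free of `ε_{a₀}` (derived here).
[cite: AbramovichTemkinWlodarczyk2024, Thm. 5.3.1 (2)–(3) (p. 1578)] -/
theorem coeff_coeff_killSlot_aeval_map_eq_zero (a₀ : ι) (φ : ι → MvPolynomial ι k[X]) (c : k)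
    (j : ℕ) (hφ : φ a₀ = X a₀ + C (Polynomial.C c * Polynomial.X ^ j))
    (G₀' : MvPolynomial ι k) (hG₀ : a₀ ∉ G₀'.vars) (R : MvPolynomial ι k[X])
    (hiso : aeval φ (map Polynomial.C G₀' + X a₀ ^ p * R) = map Polynomial.C G₀' + X a₀ ^ p * R)
    {s : ℕ} (hs1 : 1 ≤ s) (hs : s < j * p) (t : ι →₀ ℕ) :
    ((killSlot a₀ (aeval φ (map Polynomial.C G₀'))).coeff t).coeff s = 0 :=
  coeff_coeff_killSlot_aeval_eq_zero p a₀ φ c j hφ _ R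
    (fun h => hG₀ (vars_map _ _ h)) (isSigmaFree_map G₀') hiso hs1 hs t

end LowOrder

end Literature.AlgebraicGeometry.Resolution.WeightedBlowup
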